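import Mathlib
import Literature.AlgebraicGeometry.Resolution.PointBlowupFlagDropMonomialStep
import Literature.AlgebraicGeometry.Resolution.PointBlowupFlagStepTyped
import Summits.ResolutionOfSingularities.ResolutionOfSingularities.Theorems.WeightedInvariantLocalWeightedDropWildPurePowerFlagAttain

/-!
# `WeightedInvariant.LocalWeightedDrop`, line `hasse-ridge-face-selection`, piece S3πM: the DROP statement split — axis points,
# the kangaroo points, and the reduction of a translated point with one lost component to an axis point of a sheared parent

Crux item stmt-ResolutionOfSingularities-8899 `LocalWeightedDrop` (route `ResolutionOfSingularities/WeightedInvariant`), serving the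
door `WeightedConstruction` stmt-ResolutionOfSingularities-0571.  [OURS · L1 W4.3, chain w43, stub worker 1 (gen 3).  Not a statement of
any manuscript.  Printed source of the case distinction: H. Hauser, S. Perlega, PRIMS **60** (2024), Prop. 4 proof p. 793 l. 28–38: "Either
t = 0 … or t ≠ 0 and E_a = V(xy) … or t ≠ 0 and [one component] … can be transformed into the first case by … replacing y by y + tx".]

`DropStatement p e k` (the last hypothesis of S3πM, `…WildPurePowerFlagStatements`) follows from
* `DropZeroStatement p e k` — the AXIS successor `x^q·T = B(x, xy)` ([HP24, Prop. 4] cases (i), (iii), (iv) with `t = 0`): every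
  admissible flag of the child (either orientation) is beaten by a FIRST-ORIENTATION flag `V(y + f(x))` of the parent; no
  non-terminality of the parent is assumed (the printed proof does not use it);
* `DropKangarooStatement p e k` — the translated successor `x^q·T = B(x, x(t+y))`, `t ≠ 0`, with BOTH letters exceptional
  ([HP24, Prop. 4] cases (ii) and (iv) with `t ≠ 0`: "two components of E_a are lost");
by `dropStatement_of_split`: the remaining configuration — `t ≠ 0` and `y` not exceptional — is the axis successor of the SHEARED
parent `B_t = cleanSeries q (B(x, y + tx)) = expansion q B (t·X)` (same exceptional letters, `V(x)` being shear-stable), and the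
first-orientation flags `f` of `B_t` are the flags `t·X + f` of `B` with literally the same triple (`flagTriple_expansion_shift`).
-/

set_option linter.dupNamespace false -- mandated namespace of this single-conjunct summit

namespace Summit.ResolutionOfSingularities.ResolutionOfSingularities.Theorems

open Literature.AlgebraicGeometry.Resolution
open Literature.AlgebraicGeometry.Resolution.HauserPerlega2024

namespace PurePowerFlag

open MvPowerSeries

variable {k : Type} [Field k]

/-! ### The two sub-statements -/

/-- [HP24, Prop. 4] AT AN AXIS POINT, on the game-side flag invariant: for the successor `x^q·T = B(x, xy)` of a clean position
(`q < ord`), if the (cleaned) successor is again a position and not terminal up to a triangular change, every admissible flag of it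
— of either orientation, with boundary `succE 0 E` — is strictly beaten by a FIRST-ORIENTATION flag of `(B, E)`. -/
def DropZeroStatement (p e : ℕ) (k : Type) [Field k] : Prop :=
  ∀ (B : MvPowerSeries (Fin 2) k) (E : Finset (Fin 2)) (T : MvPowerSeries (Fin 2) k),
    cleanSeries (p ^ e) B = B → B ≠ 0 → ((p ^ e : ℕ) : ℕ∞) < B.order →
    X 0 ^ (p ^ e) * T = subst (PlaneGerm.dirChart (0 : k)) B →
    ((p ^ e : ℕ) : ℕ∞) < (cleanSeries (p ^ e) T).order → ¬ TermSub (p ^ e) (cleanSeries (p ^ e) T) →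
    ∀ (o : Bool) (g : PowerSeries k), PowerSeries.constantCoeff g = 0 →
      (IsN0 (orientE o (succE (0 : k) E)) g ∨ IsTangent (orientE o (succE (0 : k) E)) g) →
      ∃ f : PowerSeries k, PowerSeries.constantCoeff f = 0 ∧ (IsN0 E f ∨ IsTangent E f) ∧
        flagTriple (p ^ e) (orient o (cleanSeries (p ^ e) T)) (orientE o (succE (0 : k) E)) g < flagTriple (p ^ e) B E f

/-- [HP24, Prop. 4] AT A KANGAROO POINT, on the game-side flag invariant: successor `x^q·T = B(x, x(t+y))`, `t ≠ 0`, both coordinate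
lines exceptional at the parent (so both lost at the child). -/
def DropKangarooStatement (p e : ℕ) (k : Type) [Field k] : Prop :=
  ∀ (B : MvPowerSeries (Fin 2) k) (E : Finset (Fin 2)) (t : k) (T : MvPowerSeries (Fin 2) k),
    cleanSeries (p ^ e) B = B → B ≠ 0 → ((p ^ e : ℕ) : ℕ∞) < B.order → ¬ TermSub (p ^ e) B →
    t ≠ 0 → (0 : Fin 2) ∈ E → (1 : Fin 2) ∈ E →
    X 0 ^ (p ^ e) * T = subst (PlaneGerm.dirChart t) B →
    ((p ^ e : ℕ) : ℕ∞) < (cleanSeries (p ^ e) T).order → ¬ TermSub (p ^ e) (cleanSeries (p ^ e) T) →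
    ∀ w, IsFlagTriple (p ^ e) (cleanSeries (p ^ e) T) (succE t E) w → ∃ v, IsFlagTriple (p ^ e) B E v ∧ w < v

/-! ### The sheared parent `expansion q B (t·X)` -/

/-- The expansion is clean. -/
theorem cleanSeries_expansion (q : ℕ) (B : MvPowerSeries (Fin 2) k) (h : PowerSeries k) :
    cleanSeries q (expansion q B h) = expansion q B h :=
  cleanSeries_cleanSeries q _

/-- The expansion keeps the order. -/
theorem order_expansion (p : ℕ) [Fact p.Prime] [CharP k p] (e : ℕ) {B : MvPowerSeries (Fin 2) k} (hB : B ≠ 0)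
    (hclean : cleanSeries (p ^ e) B = B) (h : PowerSeries k) (h0 : PowerSeries.constantCoeff h = 0) :
    (expansion (p ^ e) B h).order = B.order := by
  apply le_antisymm
  · obtain ⟨d, hd, hdeg⟩ := exists_coeff_expansion_degree_eq p e hB hclean h h0
    refine le_trans (order_le hd) ?_
    have hfin : B.order ≠ ⊤ := fun hh => hB (order_eq_top_iff.mp hh)
    rw [← ENat.coe_toNat hfin]
    exact_mod_cast (by rw [Finsupp.degree_eq_sum, Fin.sum_univ_two]; exact hdeg.le)
  · exact le_trans (order_le_order_subst _ (constantCoeff_shift h h0) B) (order_le_order_cleanSeries _ _)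

/-- The column `x^r`, `r = ord_x B`, of the expansion is the column `x^r` of `B` (the shift has no constant term).
[HP24 Prop. 3 proof p. 792 l. 22–27, degree `0` of "the flags agree"] -/
theorem coeff_expansion_column (p : ℕ) [Fact p.Prime] [CharP k p] (e : ℕ) {B : MvPowerSeries (Fin 2) k}
    (hclean : cleanSeries (p ^ e) B = B) (h : PowerSeries k) (h0 : PowerSeries.constantCoeff h = 0) (j : ℕ) :
    coeff (Finsupp.single 0 (ordAlong (0 : Fin 2) B).toNat + Finsupp.single 1 j) (expansion (p ^ e) B h) =
      coeff (Finsupp.single 0 (ordAlong (0 : Fin 2) B).toNat + Finsupp.single 1 j) B := by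
  classical
  set r := (ordAlong (0 : Fin 2) B).toNat with hr
  set R₁ : ℕ → PowerSeries k := fun j => PowerSeries.mk fun v =>
    coeff (Finsupp.single 0 (r + v) + Finsupp.single 1 j) (expansion (p ^ e) B 0) with hR₁def
  set R₂ : ℕ → PowerSeries k := fun j => PowerSeries.mk fun v =>
    coeff (Finsupp.single 0 (r + v) + Finsupp.single 1 j) (expansion (p ^ e) B h) with hR₂def
  have hxr : ∀ m, coeff m B ≠ 0 → r ≤ m 0 := by
    intro m hm
    have h1 := ordAlong_le (0 : Fin 2) hm
    have hfin : ordAlong (0 : Fin 2) B ≠ ⊤ := ne_top_of_le_ne_top (ENat.coe_ne_top _) h1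
    rw [← ENat.coe_toNat hfin] at h1
    rw [hr]
    exact_mod_cast h1
  have hN : ((1 : ℕ) : ℕ∞) ≤ (h - 0).order := by
    rw [sub_zero]
    refine PowerSeries.le_order _ _ fun i hi => ?_
    have : i = 0 := by simpa using hi
    rw [this, PowerSeries.coeff_zero_eq_constantCoeff, h0]
  have key := coeff_cleanShift_rows_eq_of_le_order p (0 : Fin 2) 1 (by decide) letter_cases B r hxr 0 h (map_zero _) h0 R₁ R₂
    (fun j v => by rw [hR₁def, PowerSeries.coeff_mk]; rfl) (fun j v => by rw [hR₂def, PowerSeries.coeff_mk]; rfl) hN j 0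
    (Nat.zero_lt_one)
  rw [hR₁def, hR₂def, PowerSeries.coeff_mk, PowerSeries.coeff_mk, add_zero, expansion_zero, hclean] at key
  exact key

/-- The `x`-order of the expansion is the `x`-order of `B` (clean, non-zero). -/
theorem ordAlong_zero_expansion (p : ℕ) [Fact p.Prime] [CharP k p] (e : ℕ) {B : MvPowerSeries (Fin 2) k} (hB : B ≠ 0)
    (hclean : cleanSeries (p ^ e) B = B) (h : PowerSeries k) (h0 : PowerSeries.constantCoeff h = 0) :
    ordAlong (0 : Fin 2) (expansion (p ^ e) B h) = ordAlong (0 : Fin 2) B := by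
  apply le_antisymm
  · -- the corner column survives
    obtain ⟨d, hd, hd0⟩ := exists_coeff_ne_zero_ordAlong (0 : Fin 2) hB
    have hkey := coeff_expansion_column p e hclean h h0 (d 1)
    rw [hd0, ENat.toNat_coe, ← Literature.NumberTheory.EllipticCurves.finsupp_fin_two_eq d] at hkey
    have hne : coeff d (expansion (p ^ e) B h) ≠ 0 := by rw [hkey]; exact hd
    exact le_trans (ordAlong_le (0 : Fin 2) hne) (le_of_eq hd0.symm)
  · -- the shift raises `x`-exponents
    refine le_ordAlong (0 : Fin 2) fun m hm => ?_
    have h1 := (coeff_cleanSeries_of_ne_zero (p ^ e) _ m hm).1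
    rw [expansion] at hm
    rw [h1] at hm
    rw [shift_eq] at hm
    obtain ⟨d, hd, hdx, -, -⟩ := exists_coeff_ne_zero_of_coeff_subst_shift (0 : Fin 2) 1 (by decide) letter_cases h h0 B m hm
    exact le_trans (ordAlong_le (0 : Fin 2) hd) (by exact_mod_cast hdx)

/-- With `y` not exceptional, the exceptional monomial of the expansion is that of `B`. -/
theorem excExp_expansion (p : ℕ) [Fact p.Prime] [CharP k p] (e : ℕ) {B : MvPowerSeries (Fin 2) k} (hB : B ≠ 0)
    (hclean : cleanSeries (p ^ e) B = B) {E : Finset (Fin 2)} (h1 : (1 : Fin 2) ∉ E) (h : PowerSeries k)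
    (h0 : PowerSeries.constantCoeff h = 0) : excExp (expansion (p ^ e) B h) E = excExp B E := by
  rw [excExp_eq_single_of_not_mem h1, excExp_eq_single_of_not_mem (B := B) h1]
  congr 1
  by_cases h0E : (0 : Fin 2) ∈ E
  · rw [excExp_apply_of_mem h0E, excExp_apply_of_mem h0E, ordAlong_zero_expansion p e hB hclean h h0]
  · rw [excExp_apply_of_not_mem h0E, excExp_apply_of_not_mem h0E]

/-- With `y` not exceptional, the residual order of the expansion is that of `B`. -/
theorem dRes_expansion (p : ℕ) [Fact p.Prime] [CharP k p] (e : ℕ) {B : MvPowerSeries (Fin 2) k} (hB : B ≠ 0)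
    (hclean : cleanSeries (p ^ e) B = B) {E : Finset (Fin 2)} (h1 : (1 : Fin 2) ∉ E) (h : PowerSeries k)
    (h0 : PowerSeries.constantCoeff h = 0) : dRes (expansion (p ^ e) B h) E = dRes B E := by
  have := dRes_add_degree_excExp (expansion_ne_zero p e hB hclean h h0) E
  rw [excExp_expansion p e hB hclean h1 h h0, order_expansion p e hB hclean h h0, ← dRes_add_degree_excExp hB E] at this
  omega

/-- Iterated expansion: `expansion q (expansion q B h₁) h₂ = expansion q B (h₁ + h₂)` ("re-basing" the flags of the sheared parent).
[HP24 Prop. 3 proof p. 792 l. 20–24] -/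
theorem expansion_expansion (p : ℕ) [Fact p.Prime] [CharP k p] (e : ℕ) (B : MvPowerSeries (Fin 2) k)
    (h₁ h₂ : PowerSeries k) (h₁0 : PowerSeries.constantCoeff h₁ = 0) (h₂0 : PowerSeries.constantCoeff h₂ = 0) :
    expansion (p ^ e) (expansion (p ^ e) B h₁) h₂ = expansion (p ^ e) B (h₁ + h₂) := by
  unfold expansion
  rw [cleanSeries_subst_cleanSeries p e (hasSubst_shift' h₂ h₂0), shift_eq, shift_eq, shift_eq,
    subst_shift_subst_shift (0 : Fin 2) 1 (by decide) h₁ h₂ h₁0 h₂0 B]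

/-- THE FLAGS OF THE SHEARED PARENT ARE FLAGS OF THE PARENT, WITH THE SAME TRIPLE: for `y` not exceptional,
`flagTriple q (expansion q B h₁) E f = flagTriple q B E (h₁ + f)`. [HP24 Prop. 4 proof p. 793 l. 36–38: "replacing then y by y + tx"] -/
theorem flagTriple_expansion_shift (p : ℕ) [Fact p.Prime] [CharP k p] (e : ℕ) {B : MvPowerSeries (Fin 2) k} (hB : B ≠ 0)
    (hclean : cleanSeries (p ^ e) B = B) {E : Finset (Fin 2)} (h1 : (1 : Fin 2) ∉ E) (h₁ f : PowerSeries k)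
    (h₁0 : PowerSeries.constantCoeff h₁ = 0) (hf0 : PowerSeries.constantCoeff f = 0) :
    flagTriple (p ^ e) (expansion (p ^ e) B h₁) E f = flagTriple (p ^ e) B E (h₁ + f) := by
  rw [flagTriple_of_isN0 _ _ (Or.inl h1 : IsN0 E f), flagTriple_of_isN0 _ _ (Or.inl h1 : IsN0 E (h₁ + f)),
    dRes_expansion p e hB hclean h1 h₁ h₁0]
  congr 3
  unfold sFlag residual
  rw [dRes_expansion p e hB hclean h1 h₁ h₁0, excExp_expansion p e hB hclean h1 h₁ h₁0,
    expansion_expansion p e B h₁ f h₁0 hf0]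

/-! ### The successor of the sheared parent -/

/-- A series without constant term becomes divisible by `x` under `(x, y) ↦ (x, xy)`. -/
theorem exists_subst_step_eq_X_mul (ψ : MvPowerSeries (Fin 2) k) (hψ : constantCoeff ψ = 0) :
    ∃ ψ₁ : MvPowerSeries (Fin 2) k, subst (fun l : Fin 2 => if l = (1 : Fin 2) then (X 0 : MvPowerSeries (Fin 2) k) * X 1
      else X l) ψ = X 0 * ψ₁ := by
  refine (X_dvd_iff).mpr fun m hm => ?_
  rw [coeff_subst_step (0 : Fin 2) 1 (by decide) letter_cases ψ m]
  split_ifs with hle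
  · have h1 : m 1 = 0 := by omega
    rw [hm, h1, Nat.sub_zero, Finsupp.single_zero, Finsupp.single_zero, add_zero, coeff_zero_eq_constantCoeff_apply, hψ]
  · rfl

/-- THE SUCCESSOR AT SLOPE `t` IS, UP TO A `q`-TH POWER, THE AXIS SUCCESSOR OF THE SHEARED PARENT: from
`x^q·T = B(x, x(t+y))` one gets `T'` with `x^q·T' = B_t(x, xy)`, `B_t = expansion q B (t·X)`, and `cleanSeries q T' = cleanSeries q T`. -/
theorem exists_axis_successor_of_shear (p : ℕ) [Fact p.Prime] [CharP k p] [PerfectRing k p] (e : ℕ)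
    {B T : MvPowerSeries (Fin 2) k} (hBord : ((p ^ e : ℕ) : ℕ∞) < B.order) (t : k)
    (hT : X 0 ^ (p ^ e) * T = subst (PlaneGerm.dirChart t) B) :
    ∃ T' : MvPowerSeries (Fin 2) k,
      X 0 ^ (p ^ e) * T' = subst (PlaneGerm.dirChart (0 : k)) (expansion (p ^ e) B (PowerSeries.C t * PowerSeries.X)) ∧
      cleanSeries (p ^ e) T' = cleanSeries (p ^ e) T := by
  set q := p ^ e with hq
  set h₁ : PowerSeries k := PowerSeries.C t * PowerSeries.X with hh₁
  have h₁0 : PowerSeries.constantCoeff h₁ = 0 := by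
    rw [hh₁, map_mul, PowerSeries.constantCoeff_X, mul_zero]
  set Bt : MvPowerSeries (Fin 2) k := subst (shift h₁) B with hBt
  have hBt0 : constantCoeff Bt = 0 := by
    rw [← coeff_zero_eq_constantCoeff_apply]
    exact coeff_of_lt_order (lt_of_le_of_lt (by simp) (lt_of_lt_of_le hBord (order_le_order_subst _ (constantCoeff_shift h₁ h₁0) B)))
  obtain ⟨ψ, hψ0, hψ⟩ := exists_add_pow_eq_cleanSeries p e Bt hBt0
  obtain ⟨ψ₁, hψ₁⟩ := exists_subst_step_eq_X_mul ψ hψ0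
  have hst := hasSubst_step (K := k) (0 : Fin 2) 1
  refine ⟨T + ψ₁ ^ q, ?_, cleanSeries_add_pow p e T ψ₁⟩
  have hexp : expansion q B h₁ = Bt + ψ ^ q := by rw [expansion, ← hBt, hψ]
  rw [← step_eq_dirChart_zero, hexp, ← coe_substAlgHom hst, map_add, map_pow, coe_substAlgHom, hψ₁, hBt, shift_eq, hh₁,
    ← subst_dirChart_eq_step_shift t B, ← hT, mul_pow, mul_add]

/-! ### The reduction -/

/-- **`DropStatement` FROM THE TWO SUB-STATEMENTS.**  Axis points: `DropZeroStatement` directly.  Translated points with both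
letters exceptional: `DropKangarooStatement`.  Translated points with `y` not exceptional: `DropZeroStatement` for the sheared parent
`expansion q B (t·X)` and its axis successor, transporting the winning flag `f` to `t·X + f`. [HP24 Prop. 4 proof p. 793 l. 28–38] -/
theorem dropStatement_of_split (p : ℕ) [Fact p.Prime] (k : Type) [Field k] [CharP k p] [PerfectRing k p] (e : ℕ)
    (h0 : DropZeroStatement p e k) (hK : DropKangarooStatement p e k) : DropStatement p e k := by
  intro B E t T hclean hB hBord hnT hE hT hTord hTn w hw
  set q := p ^ e with hq
  by_cases ht : t = 0
  · subst ht
    obtain ⟨o, g, hg0, hadm, rfl⟩ := hw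
    obtain ⟨f, hf0, hfadm, hlt⟩ := h0 B E T hclean hB hBord hT hTord hTn o g hg0 hadm
    exact ⟨flagTriple q B E f, ⟨false, f, hf0, hfadm, rfl⟩, hlt⟩
  · by_cases h1 : (1 : Fin 2) ∈ E
    · exact hK B E t T hclean hB hBord hnT ht (hE ht h1) h1 hT hTord hTn w hw
    · -- `y` not exceptional: the sheared parent
      have hsucc : succE t E = succE (0 : k) E := by
        unfold succE
        rw [if_neg (fun h => ht h.1), if_neg (fun h => h1 h.2)]
      set h₁ : PowerSeries k := PowerSeries.C t * PowerSeries.X with hh₁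
      have h₁0 : PowerSeries.constantCoeff h₁ = 0 := by
        rw [hh₁, map_mul, PowerSeries.constantCoeff_X, mul_zero]
      obtain ⟨T', hT', hTT'⟩ := exists_axis_successor_of_shear p e hBord t hT
      have hB' : expansion q B h₁ ≠ 0 := expansion_ne_zero p e hB hclean h₁ h₁0
      have hB'ord : ((q : ℕ) : ℕ∞) < (expansion q B h₁).order := by
        rw [order_expansion p e hB hclean h₁ h₁0]; exact hBord
      obtain ⟨o, g, hg0, hadm, rfl⟩ := hw
      rw [hsucc] at hadm ⊢
      obtain ⟨f, hf0, hfadm, hlt⟩ := h0 (expansion q B h₁) E T' (cleanSeries_expansion q B h₁) hB' hB'ord hT'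
        (by rw [hTT']; exact hTord) (by rw [hTT']; exact hTn) o g hg0 hadm
      rw [hTT', flagTriple_expansion_shift p e hB hclean h1 h₁ f h₁0 hf0] at hlt
      refine ⟨flagTriple q B E (h₁ + f), ⟨false, h₁ + f, ?_, Or.inl (Or.inl h1), rfl⟩, hlt⟩
      rw [map_add, h₁0, hf0, add_zero]

end PurePowerFlag

end Summit.ResolutionOfSingularities.ResolutionOfSingularities.Theorems
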